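/-
Origin: expansion seat `planner-pub-hodgecm-landherr-g2-0`, handover 2026-08-18T03:37:52Z (`HOME/pub-hodgecm-landherr-g2/PerLOfNodes.lean`, md5 bf0b9a09, 55 lines);
landed by the gen-5 packager in gate run 19 as `HodgeCM/PerL34/AssemblyNoLandherr.lean` (import ^import LandherrG2\.SeesawConstruction\b→import HodgeCM.Proofs.SeesawConstruction ×1).
-/
/-
Copyright: pub-hodgecm formalisation cell (harness21, 2026). New file (not vendored).
Origin: HOME/pub-hodgecm-landherr-g2/PerLOfNodes.lean — session planner-pub-hodgecm-landherr-g2-0 (unit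
pub-hodgecm-landherr-g2, expansion part (c), gen 2).  Intended final place: `HodgeCM/PerL34/AssemblyNoLandherr.lean`
(or appended to `HodgeCM/PerL34/Assembly.lean` by the carver).  `import LandherrG2.SeesawConstruction` becomes
`import HodgeCM.Proofs.SeesawConstruction` on landing.
-/
import Summits.HodgeConjecture.HodgeCM.PerL34.Assembly
import Summits.HodgeConjecture.HodgeCM.Proofs.SeesawConstruction_2

set_option autoImplicit false

/-!
# N34 from the DAG nodes WITHOUT node N14 (Landherr)

`HodgeCM.PerL34.perL_of_nodes` (carver, `HodgeCM/PerL34/Assembly.lean`) takes one hypothesis per typed open node of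
`HOME/LEMMAS.md`, among them `h14 : N14_landherr` (= `HodgeCM.Lemma33bLandherr`, PerL v5 §3.2 tex ll. 299–304), and
`perL_of_nodes_HM` / `perL_of_nodes_split` discharge it from the PRINT input `HasseMinkowskiQuinary`.  Since
`HodgeCM.Proofs.SeesawConstruction` constructs Def 3.2's seesaw plane directly
(`ThetaModel.exists_seesawDatum_constructed`, `ThetaModel.realisationExistsPerL_of''`), node N14 is no longer a
hypothesis of PerL at all: the versions below drop `h14` / `hHM` and are otherwise the carver's statements verbatim.
-/

noncomputable section

namespace HodgeCM
namespace PerL34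

variable {U : Universe}

/-- **N34 = PerL v5 Theorem 4.4 from the DAG nodes, N14-free**: `perL_of_nodes` without the hypothesis
`h14 : N14_landherr` (Def 3.2's seesaw plane is constructed, `HodgeCM.Proofs.SeesawConstruction`).  PROVED:
`Assembly.perL ∘ ThetaModel.realisationExistsPerL_of''`. -/
theorem perL_of_nodes'' (M : U.ModelAxioms) (T : U.ThetaModel)
    (h07 : N07_hodgeRiemann20 U) (h09a : N09a_embCover T) (h09b : N09b_innerEmb T)
    (h12a : N12a_thetaSub T) (h12b : N12b_signRecipe T)
    (h19w : N19w_wedgeMem T) (h19g : N19g_genInWedgeSpan T) (h29 : N29_occ T) (h31 : N31_chars T)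
    (h33 : N33_wedge T) : U.PerL :=
  Assembly.perL U M
    (T.realisationExistsPerL_of'' M (axioms_of_nodes T h09a h09b h12a h12b h19w h19g h29 h31 h33) h07)

/-- The same with the second-layer HONEST SPLITS of N29 and N31 (cf. `perL_of_nodes_split`), N14-free and
Hasse–Minkowski-free. -/
theorem perL_of_nodes_split'' (M : U.ModelAxioms) (T : U.ThetaModel)
    (h07 : N07_hodgeRiemann20 U) (h09a : N09a_embCover T) (h09b : N09b_innerEmb T)
    (h12a : N12a_thetaSub T) (h12b : N12b_signRecipe T)
    (h19w : N19w_wedgeMem T) (h19g : N19g_genInWedgeSpan T) (h29 : N29_split T) (h31 : N31_split T)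
    (h33 : N33_wedge T) : U.PerL :=
  perL_of_nodes'' M T h07 h09a h09b h12a h12b h19w h19g (N29_of_occDischarge T h29)
    (N31_of_charsDischarge T h31) h33

end PerL34
end HodgeCM

end
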